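import Summits.QuantumFields.YangMills.Theorems.FemtoCutoffLadderDyadicTelescoping

/-!
# Femto transfer gap — the TOWER LADDER with the incommensurable step in EVENTUALLY form, and with the step taken UPWARD
# (reshape evidence for crux `SubOctaveBounded`, stmt-QuantumFields-24085, routes `FemtoCutoffLadder` / `FlatTubeReduction`)

Seat `ym-line-fcl-p3` (2026-08-28), on the shared crux `SubOctaveBounded` (rung R2b1 leaf `FemtoGapOfRecord`; RECORD rung — not infinite
volume, not a mass gap, not Clay; no summit is proved by anything in this module).

The proved assemblies of both routes (`FemtoCutoffLadderAssembly2`, `FlatTubeReductionAssembly`) consume the incommensurable step through the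
tower ladder `CutoffLadder.femtoGapOfRecord_of_towerLadder`, whose step hypothesis (hB) is the item AS FILED: threshold `L₀` fixed BEFORE the
level `lam`, pairs `L₀ ≤ L' ≤ L < 2L'`, direction «coarse below fine»
`λ₁(β,L)^L·λ₀(β',L')^{L'} ≤ e^{CΛ²}·λ₁(β',L')^{L'}·λ₀(β,L)^L` (the FINE lattice `L` carries the excited value on the left).  Two observations,
both kernel-checked here:

* **(quantifier order)** the leaf `FemtoGapOfRecord` fixes its own threshold AFTER the level (`∀ lam, ∃ L₀, ∀ L ≥ L₀`), and the existing ladder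
  never uses that slack (`L₀(lam) = 0`).  If the chain of nested octave steps is run down the tower ALL THE WAY to its base `L₀ᵒ` (the tower
  step `OctaveStepDecay` holds for every index `i`), the bounded step is needed only for pairs above a threshold that may depend on `lam`:
  ★ `femtoGapOfRecord_of_towerLadder_eventually` — (hB) weakened to `∀ lam, ∃ L₀`.
* **(direction)** for an arbitrary lattice `L` one may compare with the tower partner ABOVE it (`L < m = L₀ᵒ·2^{j+1} < 2L`) instead of the one
  below; then the incommensurable step is consumed in the OPPOSITE direction «fine below coarse»
  `λ₁(β',L')^{L'}·λ₀(β,L)^L ≤ e^{CΛ²}·λ₁(β,L)^L·λ₀(β',L')^{L'}` (`L' < L < 2L'`, the COARSE lattice carries the excited value on the left) — the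
  second conjunct of the retired two-sided `UniformStepScaling`, dropped at rev 2 as idle.  ★★ `femtoGapOfRecord_of_towerLadder_up` —
  (hU) = that conjunct, in eventually form.  In gap language (`z̃ = −L log(λ₁/λ₀)` at matched `Λ`): the filed direction asks
  `z̃(fine) ≥ z̃(coarse) − CΛ²` (a LOWER bound on the fine gap: non-collapse of the spectral gap under refinement, a Poincaré-type statement,
  the same kind as `OctaveStepDecay`), the upward direction asks `z̃(fine) ≤ z̃(coarse) + CΛ²` (an UPPER bound on the fine gap: the variational
  direction — one slow observable / interpolated trial family on the fine lattice in the ground-state representation suffices).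

Shared core: `tower_chain` (the lower law on every tower lattice `L₀ᵒ·2^j` from the tower step, the coarse pair AT THE BASE ONLY, the anchor and
matching; potential `Φ(m) = K₀ + (C⁺/κ)(1 − m^{−σ})`, `κ = 1 − 2^{−σ}`, `K₀ = |C_a| + |C_{L₀ᵒ}|`, telescoping allowance `D(Λ³/2 − 1/β)`).

HONEST FRAMING: bookkeeping (real analysis over the tree's positivity lemmas); neither step nor the fixed-lattice leaf is proved here; whether the
reshaped step is provable is untouched (it is still a two-cutoff comparison deep in the femto window, barrier `UVStabilityNonUniqueness`).
No definitions, no named facts, no `sorry`.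
-/

set_option autoImplicit false

noncomputable section

namespace Summit.QuantumFields.YangMills.Theorems.FemtoTransferGap.CutoffLadder

open Real
open Summit.QuantumFields.YangMills.Theorems.FemtoTransferGap
open Literature.Analysis.OperatorTheory.YMMatrixModel (luscherEps1)

/-! ## §1 The chain down one tower to its base -/

set_option maxHeartbeats 400000 in
/-- **The tower chain.**  From the nested octave step along ONE tower `L' = L₀ᵒ·2^i` (slack `exp(CΛ²/L'^σ + D(1/β' − 1/β))`, `D ≥ 0`, every
index `i`), the coarse pair `(L₀ᵒ, 1)` (only the base is used), the one-site anchor and deep-window matching: there are `K ≥ 0` and a level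
`lam₁ ∈ (0, 1/2]` such that every window point `(β, m)` of level `lam ≤ lam₁` on a tower lattice `m = L₀ᵒ·2^j` obeys
`λ₁^m ≤ exp(−ε₁Λ + KΛ² + D(Λ³/2 − 1/β))·λ₀^m` (`K = |C_a| + |C_{L₀ᵒ}| + max(C,0)/(1 − 2^{−σ})`; induction on `j`, the step slack paid by the
potential `m^{−σ}`, the partner's `−D/β'` cancelling the step's `+D/β'`). [cite: LuscherWeiszWolff1991] [cite: AllesFeoPanagopoulos1997, eq. (3.7)] -/
theorem tower_chain {Co σ D lamO : ℝ} {L0o : ℕ} (hL0o : 0 < L0o) (hσ : 0 < σ) (hlamO : 0 < lamO) (hD : 0 ≤ D)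
    (HO : ∀ lam : ℝ, 0 < lam → lam ≤ lamO →
      ∀ (i : ℕ) (L' : ℕ) [NeZero L'] (L : ℕ) [NeZero L], L' = L0o * 2 ^ i → L = 2 * L' →
        ∀ β β' : ℝ, InFemtoWindow lam β L → InFemtoWindow lam β' L' → luscherLambda β L = luscherLambda β' L' →
          secondValue su2Rep L β ^ L * topValue su2Rep L' β' ^ L' ≤
            Real.exp (Co * luscherLambda β L ^ 2 / (L' : ℝ) ^ σ + D * (1 / β' - 1 / β)) *
              (secondValue su2Rep L' β' ^ L' * topValue su2Rep L β ^ L))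
    (hP : ∀ (L : ℕ) [NeZero L], ∃ C lam0 : ℝ, 0 < lam0 ∧ ∀ lam : ℝ, 0 < lam → lam ≤ lam0 →
      ∀ β β' : ℝ, InFemtoWindow lam β L → InFemtoWindow lam β' 1 → luscherLambda β L = luscherLambda β' 1 →
        secondValue su2Rep L β ^ L * topValue su2Rep 1 β' ^ 1 ≤
          Real.exp (C * luscherLambda β L ^ 2) * (secondValue su2Rep 1 β' ^ 1 * topValue su2Rep L β ^ L))
    (hA : ∃ C lam0 : ℝ, 0 < lam0 ∧ ∀ lam : ℝ, 0 < lam → lam ≤ lam0 → ∀ β : ℝ, InFemtoWindow lam β 1 →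
      secondValue su2Rep 1 β ≤ Real.exp (-(zLower C β 1)) * topValue su2Rep 1 β)
    (hM : ∀ lam : ℝ, 0 < lam → lam ≤ 1 / 2 → ∀ (L : ℕ) [NeZero L] (L' : ℕ) [NeZero L'] (β : ℝ),
      InFemtoWindow lam β L → ∃ β' : ℝ, InFemtoWindow lam β' L' ∧ luscherLambda β' L' = luscherLambda β L) :
    ∃ K lam1 : ℝ, 0 ≤ K ∧ 0 < lam1 ∧ lam1 ≤ 1 / 2 ∧ ∀ lam : ℝ, 0 < lam → lam ≤ lam1 →
      ∀ (j : ℕ) (m : ℕ) [NeZero m], m = L0o * 2 ^ j → ∀ β : ℝ, InFemtoWindow lam β m →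
        secondValue su2Rep m β ^ m ≤
          Real.exp (-(luscherEps1 * luscherLambda β m) + K * luscherLambda β m ^ 2 +
            D * (luscherLambda β m ^ 3 / 2 - 1 / β)) * topValue su2Rep m β ^ m := by
  obtain ⟨Ca, lamA, hlamA, HA⟩ := hA
  haveI : NeZero L0o := ⟨hL0o.ne'⟩
  obtain ⟨Cp, lamP, hlamP, HP⟩ := hP L0o
  set Cop : ℝ := max Co 0 with hCop
  have hCop0 : 0 ≤ Cop := le_max_right _ _
  have hCole : Co ≤ Cop := le_max_left _ _
  set q : ℝ := (1 / 2 : ℝ) ^ σ with hq_def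
  have hq1 : q < 1 := Real.rpow_lt_one (by norm_num) (by norm_num) hσ
  set κ : ℝ := 1 - q with hκ_def
  have hκ : 0 < κ := by rw [hκ_def]; linarith
  have hqκ : q = 1 - κ := by rw [hκ_def]; ring
  set K0 : ℝ := |Ca| + |Cp| with hK0
  have hK0nn : 0 ≤ K0 := by positivity
  have hck : 0 ≤ Cop / κ := div_nonneg hCop0 hκ.le
  -- potential and running constant along the chain
  let w : ℕ → ℝ := fun m => (((m : ℕ) : ℝ) ^ σ)⁻¹
  let Φ : ℕ → ℝ := fun m => K0 + Cop / κ * (1 - w m)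
  have hw0 : ∀ m : ℕ, 0 ≤ w m := fun m => inv_nonneg.mpr (Real.rpow_nonneg (Nat.cast_nonneg m) σ)
  have hw1 : ∀ m : ℕ, 0 < m → w m ≤ 1 := fun m hm => by
    haveI : NeZero m := ⟨Nat.pos_iff_ne_zero.mp hm⟩
    exact potential_le_one hσ.le m
  have hΦle : ∀ m : ℕ, Φ m ≤ K0 + Cop / κ := fun m => by
    have : Cop / κ * (1 - w m) ≤ Cop / κ := by nlinarith [hw0 m]
    show K0 + Cop / κ * (1 - w m) ≤ K0 + Cop / κ
    linarith
  have hΦge : ∀ m : ℕ, 0 < m → K0 ≤ Φ m := fun m hm => by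
    have : 0 ≤ Cop / κ * (1 - w m) := mul_nonneg hck (by linarith [hw1 m hm])
    show K0 ≤ K0 + Cop / κ * (1 - w m)
    linarith
  refine ⟨K0 + Cop / κ, min (min lamO lamP) (min lamA (1 / 2)), by positivity,
    lt_min (lt_min hlamO hlamP) (lt_min hlamA (by norm_num)), (min_le_right _ _).trans (min_le_right _ _), ?_⟩
  intro lam hlam hle
  have hleO : lam ≤ lamO := hle.trans ((min_le_left _ _).trans (min_le_left _ _))
  have hleP : lam ≤ lamP := hle.trans ((min_le_left _ _).trans (min_le_right _ _))
  have hleA : lam ≤ lamA := hle.trans ((min_le_right _ _).trans (min_le_left _ _))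
  have hhalf : lam ≤ 1 / 2 := hle.trans ((min_le_right _ _).trans (min_le_right _ _))
  -- base of the tower: coarse pair `(L₀ᵒ, 1)` + anchor, exponent `−ε₁Λ + K0·Λ²`
  have base : ∀ β : ℝ, InFemtoWindow lam β L0o →
      secondValue su2Rep L0o β ^ L0o ≤
        Real.exp (-(luscherEps1 * luscherLambda β L0o) + K0 * luscherLambda β L0o ^ 2) *
          topValue su2Rep L0o β ^ L0o := by
    intro β hW
    set Λ : ℝ := luscherLambda β L0o with hΛ
    have hb : 0 ≤ topValue su2Rep L0o β ^ L0o := pow_nonneg (topValue_su2Rep_pos L0o β).le _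
    obtain ⟨β', hW', hmatch⟩ := hM lam hlam hhalf L0o 1 β hW
    have h1 := HP lam hlam hleP β β' hW hW' hmatch.symm
    simp only [pow_one] at h1
    have h2 := HA lam hlam hleA β' hW'
    have hb' : 0 < topValue su2Rep 1 β' := topValue_su2Rep_pos 1 β'
    have h3 := le_of_pair_of_partner hb' hb h1 h2
    refine h3.trans (exp_mul_le_exp_mul ?_ hb)
    have hz : zLower Ca β' 1 = luscherEps1 * Λ - Ca * Λ ^ 2 := by
      show luscherEps1 * luscherLambda β' 1 - Ca * luscherLambda β' 1 ^ 2 = _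
      rw [hmatch]
    rw [hz]
    have hCp : Cp ≤ |Cp| := le_abs_self _
    have hCa : Ca ≤ |Ca| := le_abs_self _
    have hsum : (Cp + Ca) * Λ ^ 2 ≤ K0 * Λ ^ 2 :=
      mul_le_mul_of_nonneg_right (by rw [hK0]; linarith) (sq_nonneg Λ)
    linarith
  -- the nested chain `L₀ᵒ·2^j`, induction on `j`
  have chain : ∀ j : ℕ, ∀ (m : ℕ) [NeZero m], m = L0o * 2 ^ j → ∀ β : ℝ, InFemtoWindow lam β m →
      secondValue su2Rep m β ^ m ≤
        Real.exp (-(luscherEps1 * luscherLambda β m) + Φ m * luscherLambda β m ^ 2 +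
            D * (luscherLambda β m ^ 3 / 2 - 1 / β)) * topValue su2Rep m β ^ m := by
    intro j
    induction j with
    | zero =>
      intro m _ hm β hW
      rw [pow_zero, mul_one] at hm
      subst m
      have hb : 0 ≤ topValue su2Rep L0o β ^ L0o := pow_nonneg (topValue_su2Rep_pos L0o β).le _
      have h := base β hW
      refine h.trans (exp_mul_le_exp_mul ?_ hb)
      have hbud : 0 ≤ D * (luscherLambda β L0o ^ 3 / 2 - 1 / β) :=
        mul_nonneg hD (by linarith [inv_le_half_luscherLambda_cube hlam hW])
      have hK : K0 * luscherLambda β L0o ^ 2 ≤ Φ L0o * luscherLambda β L0o ^ 2 :=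
        mul_le_mul_of_nonneg_right (hΦge L0o hL0o) (sq_nonneg _)
      linarith
    | succ j ih =>
      intro m _ hm β hW
      set m' : ℕ := L0o * 2 ^ j with hm'
      have hm'pos : 0 < m' := by positivity
      haveI : NeZero m' := ⟨hm'pos.ne'⟩
      have hmm' : m = 2 * m' := by rw [hm, hm', pow_succ]; ring
      set Λ : ℝ := luscherLambda β m with hΛ
      have hb : 0 ≤ topValue su2Rep m β ^ m := pow_nonneg (topValue_su2Rep_pos m β).le _
      obtain ⟨β', hW', hmatch⟩ := hM lam hlam hhalf m m' β hW
      have h1 := HO lam hlam hleO j m' m hm' hmm' β β' hW hW' hmatch.symm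
      have h2 := ih m' hm' β' hW'
      have hb' : 0 < topValue su2Rep m' β' ^ m' := pow_pos (topValue_su2Rep_pos m' β') _
      have h3 := le_of_pair_of_partner hb' hb h1 h2
      refine h3.trans (exp_mul_le_exp_mul ?_ hb)
      rw [hmatch]
      have hslack : Co * Λ ^ 2 / ((m' : ℕ) : ℝ) ^ σ = Co * w m' * Λ ^ 2 := by
        show Co * Λ ^ 2 / ((m' : ℕ) : ℝ) ^ σ = Co * (((m' : ℕ) : ℝ) ^ σ)⁻¹ * Λ ^ 2
        ring
      rw [hslack]
      have hcontr : w m ≤ q * w m' := by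
        show (((m : ℕ) : ℝ) ^ σ)⁻¹ ≤ (1 / 2 : ℝ) ^ σ * (((m' : ℕ) : ℝ) ^ σ)⁻¹
        rw [hmm']
        exact potential_half σ hm'pos
      have hbudget := step_budget hCole hCop0 hκ hqκ (hw0 m') hcontr
      have hΦm : Φ m = K0 + Cop / κ * (1 - w m) := rfl
      have hΦm' : Φ m' = K0 + Cop / κ * (1 - w m') := rfl
      rw [hΦm, hΦm']
      have hsplit : D * (Λ ^ 3 / 2 - 1 / β') = D * (Λ ^ 3 / 2) - D * (1 / β') := by ring
      have hsplit2 : D * (Λ ^ 3 / 2 - 1 / β) = D * (Λ ^ 3 / 2) - D * (1 / β) := by ring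
      have hsplit3 : D * (1 / β' - 1 / β) = D * (1 / β') - D * (1 / β) := by ring
      have hprod : (Co * w m' + (K0 + Cop / κ * (1 - w m'))) * Λ ^ 2 ≤ (K0 + Cop / κ * (1 - w m)) * Λ ^ 2 :=
        mul_le_mul_of_nonneg_right (by linarith) (sq_nonneg Λ)
      have hexp : (Co * w m' + (K0 + Cop / κ * (1 - w m'))) * Λ ^ 2 =
          Co * w m' * Λ ^ 2 + (K0 + Cop / κ * (1 - w m')) * Λ ^ 2 := by ring
      rw [hsplit3, hsplit, hsplit2]
      linarith [hprod, hexp]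
  -- uniform constant
  intro j m _ hm β hW
  have h := chain j m hm β hW
  have hb : 0 ≤ topValue su2Rep m β ^ m := pow_nonneg (topValue_su2Rep_pos m β).le _
  refine h.trans (exp_mul_le_exp_mul ?_ hb)
  have hK : Φ m * luscherLambda β m ^ 2 ≤ (K0 + Cop / κ) * luscherLambda β m ^ 2 :=
    mul_le_mul_of_nonneg_right (hΦle m) (sq_nonneg _)
  linarith

/-! ## §2 The filed direction («coarse below fine»), threshold AFTER the level -/

set_option maxHeartbeats 400000 in
/-- ★ **Tower ladder, bounded step in EVENTUALLY form.**  (hO) the nested octave step along one tower (verbatim body of `OctaveStepDecay`,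
stmt-QuantumFields-24153); (hB) the bounded incommensurable step «coarse below fine» for pairs `L₀ ≤ L' ≤ L < 2L'` — exactly the body of
`SubOctaveBounded` (stmt-QuantumFields-24085) EXCEPT that the threshold `L₀` is chosen AFTER the level `lam` (`∀ lam, ∃ L₀`, the quantifier
pattern of the leaf itself); (hP) coarse pairs `(L,1)`; (hA) one-site anchor; (hM) deep-window matching ⟹ `FemtoGapOfRecord`, with
`C = max(C_B,0) + K + D/2` and `L₀(lam) = max(L₀ᵒ, 2·L₀ᴮ(lam))` (the tower partner `m ≤ L < 2m` of an admissible `L` lies above `L₀ᴮ(lam)`;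
the chain `tower_chain` supplies the lower law on `m`).  So the item may be weakened to the leaf's own quantifier order at no cost to either
assembly. [cite: LuscherWeiszWolff1991] [cite: AllesFeoPanagopoulos1997, eq. (3.7)] -/
theorem femtoGapOfRecord_of_towerLadder_eventually
    (hO : ∃ (C σ D lam0 : ℝ) (L0 : ℕ), 0 < L0 ∧ 0 < σ ∧ 0 < lam0 ∧ 0 ≤ D ∧ ∀ lam : ℝ, 0 < lam → lam ≤ lam0 →
      ∀ (i : ℕ) (L' : ℕ) [NeZero L'] (L : ℕ) [NeZero L], L' = L0 * 2 ^ i → L = 2 * L' →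
        ∀ β β' : ℝ, InFemtoWindow lam β L → InFemtoWindow lam β' L' → luscherLambda β L = luscherLambda β' L' →
          secondValue su2Rep L β ^ L * topValue su2Rep L' β' ^ L' ≤
            Real.exp (C * luscherLambda β L ^ 2 / (L' : ℝ) ^ σ + D * (1 / β' - 1 / β)) *
              (secondValue su2Rep L' β' ^ L' * topValue su2Rep L β ^ L))
    (hB : ∃ C lam0 : ℝ, 0 < lam0 ∧ ∀ lam : ℝ, 0 < lam → lam ≤ lam0 → ∃ L0 : ℕ,
      ∀ (L' : ℕ) [NeZero L'] (L : ℕ) [NeZero L], L0 ≤ L' → L' ≤ L → L < 2 * L' →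
        ∀ β β' : ℝ, InFemtoWindow lam β L → InFemtoWindow lam β' L' → luscherLambda β L = luscherLambda β' L' →
          secondValue su2Rep L β ^ L * topValue su2Rep L' β' ^ L' ≤
            Real.exp (C * luscherLambda β L ^ 2) * (secondValue su2Rep L' β' ^ L' * topValue su2Rep L β ^ L))
    (hP : ∀ (L : ℕ) [NeZero L], ∃ C lam0 : ℝ, 0 < lam0 ∧ ∀ lam : ℝ, 0 < lam → lam ≤ lam0 →
      ∀ β β' : ℝ, InFemtoWindow lam β L → InFemtoWindow lam β' 1 → luscherLambda β L = luscherLambda β' 1 →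
        secondValue su2Rep L β ^ L * topValue su2Rep 1 β' ^ 1 ≤
          Real.exp (C * luscherLambda β L ^ 2) * (secondValue su2Rep 1 β' ^ 1 * topValue su2Rep L β ^ L))
    (hA : ∃ C lam0 : ℝ, 0 < lam0 ∧ ∀ lam : ℝ, 0 < lam → lam ≤ lam0 → ∀ β : ℝ, InFemtoWindow lam β 1 →
      secondValue su2Rep 1 β ≤ Real.exp (-(zLower C β 1)) * topValue su2Rep 1 β)
    (hM : ∀ lam : ℝ, 0 < lam → lam ≤ 1 / 2 → ∀ (L : ℕ) [NeZero L] (L' : ℕ) [NeZero L'] (β : ℝ),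
      InFemtoWindow lam β L → ∃ β' : ℝ, InFemtoWindow lam β' L' ∧ luscherLambda β' L' = luscherLambda β L) :
    FemtoGapOfRecord := by
  obtain ⟨Co, σ, D, lamO, L0o, hL0o, hσ, hlamO, hD, HO⟩ := hO
  obtain ⟨K, lam1, hK, hlam1, hhalf1, chain⟩ := tower_chain hL0o hσ hlamO hD HO hP hA hM
  obtain ⟨Cb, lamB, hlamB, HB⟩ := hB
  set Cbp : ℝ := max Cb 0 with hCbp
  have hCbp0 : 0 ≤ Cbp := le_max_right _ _
  have hCble : Cb ≤ Cbp := le_max_left _ _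
  refine ⟨Cbp + K + D / 2, min lam1 lamB, lt_min hlam1 hlamB, ?_⟩
  intro lam hlam hle
  have hle1 : lam ≤ lam1 := hle.trans (min_le_left _ _)
  have hleB : lam ≤ lamB := hle.trans (min_le_right _ _)
  have hhalf : lam ≤ 1 / 2 := hle1.trans hhalf1
  obtain ⟨L0b, HBl⟩ := HB lam hlam hleB
  refine ⟨max L0o (2 * L0b), ?_⟩
  intro L _ hL β hW
  have hLo : L0o ≤ L := (le_max_left _ _).trans hL
  have hLb : 2 * L0b ≤ L := (le_max_right _ _).trans hL
  have hΛ1 : luscherLambda β L ≤ 1 := hW.2.2.trans (by linarith)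
  have hΛ0 : 0 ≤ luscherLambda β L := hlam.le.trans hW.2.1
  have hcube : luscherLambda β L ^ 3 ≤ luscherLambda β L ^ 2 := by
    calc luscherLambda β L ^ 3 = luscherLambda β L ^ 2 * luscherLambda β L := by ring
      _ ≤ luscherLambda β L ^ 2 * 1 := mul_le_mul_of_nonneg_left hΛ1 (sq_nonneg _)
      _ = luscherLambda β L ^ 2 := mul_one _
  have hb : 0 ≤ topValue su2Rep L β ^ L := pow_nonneg (topValue_su2Rep_pos L β).le _
  have hpow : secondValue su2Rep L β ^ L ≤ Real.exp (-(zLower (Cbp + K + D / 2) β L)) * topValue su2Rep L β ^ L := by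
    obtain ⟨j, hmle, hlt⟩ := exists_dyadic_bracket hL0o hLo
    set m : ℕ := L0o * 2 ^ j with hm
    have hmpos : 0 < m := by positivity
    haveI : NeZero m := ⟨hmpos.ne'⟩
    have hL0bm : L0b ≤ m := by omega
    obtain ⟨β', hW', hmatch⟩ := hM lam hlam hhalf L m β hW
    have h1 := HBl m L hL0bm hmle hlt β β' hW hW' hmatch.symm
    have h2 := chain lam hlam hle1 j m hm β' hW'
    have hb' : 0 < topValue su2Rep m β' ^ m := pow_pos (topValue_su2Rep_pos m β') _
    have h3 := le_of_pair_of_partner hb' hb h1 h2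
    refine h3.trans (exp_mul_le_exp_mul ?_ hb)
    rw [hmatch]
    set Λ : ℝ := luscherLambda β L with hΛ
    show Cb * Λ ^ 2 + (-(luscherEps1 * Λ) + K * Λ ^ 2 + D * (Λ ^ 3 / 2 - 1 / β')) ≤
      -(luscherEps1 * Λ - (Cbp + K + D / 2) * Λ ^ 2)
    have hβ'0 : 0 < β' := by linarith [hW'.1]
    have hDβ' : 0 ≤ D * (1 / β') := mul_nonneg hD (by positivity)
    have hDc : D * (Λ ^ 3 / 2) ≤ D / 2 * Λ ^ 2 := by
      have := mul_le_mul_of_nonneg_left hcube hD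
      linarith
    have hCbΛ : Cb * Λ ^ 2 ≤ Cbp * Λ ^ 2 := mul_le_mul_of_nonneg_right hCble (sq_nonneg Λ)
    have hsplit : D * (Λ ^ 3 / 2 - 1 / β') = D * (Λ ^ 3 / 2) - D * (1 / β') := by ring
    have hC : (Cbp + K + D / 2) * Λ ^ 2 = Cbp * Λ ^ 2 + K * Λ ^ 2 + D / 2 * Λ ^ 2 := by ring
    rw [hsplit, hC]
    linarith
  exact root_of_pow_le (secondValue_su2Rep_pos (by linarith [hW.1])).le (topValue_su2Rep_pos L β).le hpow

/-! ## §3 The opposite direction («fine below coarse»): the tower partner ABOVE the lattice -/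

set_option maxHeartbeats 400000 in
/-- ★★ **Tower ladder, incommensurable step taken UPWARD.**  (hO) the nested octave step along one tower (verbatim body of
`OctaveStepDecay`); (hU) ONE bounded incommensurable step in the direction «FINE BELOW COARSE» — for pairs `L₀ ≤ L' < L < 2L'` at matched
running parameter, `λ₁(β',L')^{L'}·λ₀(β,L)^L ≤ e^{CΛ²}·λ₁(β,L)^L·λ₀(β',L')^{L'}` (the coarse lattice `L'` carries the excited value on the
left: `z̃(Λ,L) ≤ z̃(Λ,L') + CΛ²`, an UPPER bound on the fine gap — the second conjunct of the retired `UniformStepScaling`), threshold after the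
level; (hP) coarse pairs `(L,1)`; (hA) one-site anchor; (hM) deep-window matching ⟹ `FemtoGapOfRecord`, with `C = max(C_U,0) + K + D/2`,
`L₀(lam) = max(L₀ᵒ, L₀ᵁ(lam))`.  Argument: an admissible `L` is either a tower lattice (then `tower_chain` directly) or lies strictly between two
consecutive tower lattices `L₀ᵒ·2^j < L < m := L₀ᵒ·2^{j+1}`, whence `L < m < 2L`; (hU) at the pair `(L' := L, L := m)` transfers the chain's lower
law on `m` DOWN to `L`. [cite: LuscherWeiszWolff1991] [cite: AllesFeoPanagopoulos1997, eq. (3.7)] -/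
theorem femtoGapOfRecord_of_towerLadder_up
    (hO : ∃ (C σ D lam0 : ℝ) (L0 : ℕ), 0 < L0 ∧ 0 < σ ∧ 0 < lam0 ∧ 0 ≤ D ∧ ∀ lam : ℝ, 0 < lam → lam ≤ lam0 →
      ∀ (i : ℕ) (L' : ℕ) [NeZero L'] (L : ℕ) [NeZero L], L' = L0 * 2 ^ i → L = 2 * L' →
        ∀ β β' : ℝ, InFemtoWindow lam β L → InFemtoWindow lam β' L' → luscherLambda β L = luscherLambda β' L' →
          secondValue su2Rep L β ^ L * topValue su2Rep L' β' ^ L' ≤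
            Real.exp (C * luscherLambda β L ^ 2 / (L' : ℝ) ^ σ + D * (1 / β' - 1 / β)) *
              (secondValue su2Rep L' β' ^ L' * topValue su2Rep L β ^ L))
    (hU : ∃ C lam0 : ℝ, 0 < lam0 ∧ ∀ lam : ℝ, 0 < lam → lam ≤ lam0 → ∃ L0 : ℕ,
      ∀ (L' : ℕ) [NeZero L'] (L : ℕ) [NeZero L], L0 ≤ L' → L' < L → L < 2 * L' →
        ∀ β β' : ℝ, InFemtoWindow lam β L → InFemtoWindow lam β' L' → luscherLambda β L = luscherLambda β' L' →
          secondValue su2Rep L' β' ^ L' * topValue su2Rep L β ^ L ≤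
            Real.exp (C * luscherLambda β L ^ 2) * (secondValue su2Rep L β ^ L * topValue su2Rep L' β' ^ L'))
    (hP : ∀ (L : ℕ) [NeZero L], ∃ C lam0 : ℝ, 0 < lam0 ∧ ∀ lam : ℝ, 0 < lam → lam ≤ lam0 →
      ∀ β β' : ℝ, InFemtoWindow lam β L → InFemtoWindow lam β' 1 → luscherLambda β L = luscherLambda β' 1 →
        secondValue su2Rep L β ^ L * topValue su2Rep 1 β' ^ 1 ≤
          Real.exp (C * luscherLambda β L ^ 2) * (secondValue su2Rep 1 β' ^ 1 * topValue su2Rep L β ^ L))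
    (hA : ∃ C lam0 : ℝ, 0 < lam0 ∧ ∀ lam : ℝ, 0 < lam → lam ≤ lam0 → ∀ β : ℝ, InFemtoWindow lam β 1 →
      secondValue su2Rep 1 β ≤ Real.exp (-(zLower C β 1)) * topValue su2Rep 1 β)
    (hM : ∀ lam : ℝ, 0 < lam → lam ≤ 1 / 2 → ∀ (L : ℕ) [NeZero L] (L' : ℕ) [NeZero L'] (β : ℝ),
      InFemtoWindow lam β L → ∃ β' : ℝ, InFemtoWindow lam β' L' ∧ luscherLambda β' L' = luscherLambda β L) :
    FemtoGapOfRecord := by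
  obtain ⟨Co, σ, D, lamO, L0o, hL0o, hσ, hlamO, hD, HO⟩ := hO
  obtain ⟨K, lam1, hK, hlam1, hhalf1, chain⟩ := tower_chain hL0o hσ hlamO hD HO hP hA hM
  obtain ⟨Cu, lamU, hlamU, HU⟩ := hU
  set Cup : ℝ := max Cu 0 with hCup
  have hCup0 : 0 ≤ Cup := le_max_right _ _
  have hCule : Cu ≤ Cup := le_max_left _ _
  refine ⟨Cup + K + D / 2, min lam1 lamU, lt_min hlam1 hlamU, ?_⟩
  intro lam hlam hle
  have hle1 : lam ≤ lam1 := hle.trans (min_le_left _ _)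
  have hleU : lam ≤ lamU := hle.trans (min_le_right _ _)
  have hhalf : lam ≤ 1 / 2 := hle1.trans hhalf1
  obtain ⟨L0u, HUl⟩ := HU lam hlam hleU
  refine ⟨max L0o L0u, ?_⟩
  intro L _ hL β hW
  have hLo : L0o ≤ L := (le_max_left _ _).trans hL
  have hLu : L0u ≤ L := (le_max_right _ _).trans hL
  have hΛ1 : luscherLambda β L ≤ 1 := hW.2.2.trans (by linarith)
  have hΛ0 : 0 ≤ luscherLambda β L := hlam.le.trans hW.2.1
  have hβ0 : 0 < β := by linarith [hW.1]
  have hcube : luscherLambda β L ^ 3 ≤ luscherLambda β L ^ 2 := by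
    calc luscherLambda β L ^ 3 = luscherLambda β L ^ 2 * luscherLambda β L := by ring
      _ ≤ luscherLambda β L ^ 2 * 1 := mul_le_mul_of_nonneg_left hΛ1 (sq_nonneg _)
      _ = luscherLambda β L ^ 2 := mul_one _
  have hb : 0 ≤ topValue su2Rep L β ^ L := pow_nonneg (topValue_su2Rep_pos L β).le _
  have hDc : D * (luscherLambda β L ^ 3 / 2) ≤ D / 2 * luscherLambda β L ^ 2 := by
    have := mul_le_mul_of_nonneg_left hcube hD
    linarith
  have hC : (Cup + K + D / 2) * luscherLambda β L ^ 2 =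
      Cup * luscherLambda β L ^ 2 + K * luscherLambda β L ^ 2 + D / 2 * luscherLambda β L ^ 2 := by ring
  have hCupΛ : 0 ≤ Cup * luscherLambda β L ^ 2 := mul_nonneg hCup0 (sq_nonneg _)
  have hpow : secondValue su2Rep L β ^ L ≤ Real.exp (-(zLower (Cup + K + D / 2) β L)) * topValue su2Rep L β ^ L := by
    obtain ⟨j, hmle, hlt⟩ := exists_dyadic_bracket hL0o hLo
    set t : ℕ := L0o * 2 ^ j with ht
    have htpos : 0 < t := by positivity
    by_cases heq : t = L
    · -- `L` is a tower lattice: the chain directly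
      have h2 := chain lam hlam hle1 j L (heq.symm.trans ht) β hW
      refine h2.trans (exp_mul_le_exp_mul ?_ hb)
      show -(luscherEps1 * luscherLambda β L) + K * luscherLambda β L ^ 2 +
          D * (luscherLambda β L ^ 3 / 2 - 1 / β) ≤ -(luscherEps1 * luscherLambda β L - (Cup + K + D / 2) * luscherLambda β L ^ 2)
      have hDβ : 0 ≤ D * (1 / β) := mul_nonneg hD (by positivity)
      have hsplit : D * (luscherLambda β L ^ 3 / 2 - 1 / β) = D * (luscherLambda β L ^ 3 / 2) - D * (1 / β) := by ring
      rw [hsplit, hC]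
      linarith
    · -- `L` strictly between two tower lattices: partner `m = 2t` above, `L < m < 2L`
      have htL : t < L := lt_of_le_of_ne hmle heq
      set m : ℕ := L0o * 2 ^ (j + 1) with hm
      have hm2 : m = 2 * t := by rw [hm, ht, pow_succ]; ring
      have hLm : L < m := by omega
      have hm2L : m < 2 * L := by omega
      have hmpos : 0 < m := by omega
      haveI : NeZero m := ⟨hmpos.ne'⟩
      obtain ⟨β', hW', hmatch⟩ := hM lam hlam hhalf L m β hW
      have h1 := HUl L m hLu hLm hm2L β' β hW' hW hmatch
      have h2 := chain lam hlam hle1 (j + 1) m hm β' hW'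
      have hb' : 0 < topValue su2Rep m β' ^ m := pow_pos (topValue_su2Rep_pos m β') _
      have h3 := le_of_pair_of_partner hb' hb h1 h2
      refine h3.trans (exp_mul_le_exp_mul ?_ hb)
      rw [hmatch]
      set Λ : ℝ := luscherLambda β L with hΛ
      show Cu * Λ ^ 2 + (-(luscherEps1 * Λ) + K * Λ ^ 2 + D * (Λ ^ 3 / 2 - 1 / β')) ≤
        -(luscherEps1 * Λ - (Cup + K + D / 2) * Λ ^ 2)
      have hβ'0 : 0 < β' := by linarith [hW'.1]
      have hDβ' : 0 ≤ D * (1 / β') := mul_nonneg hD (by positivity)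
      have hCuΛ : Cu * Λ ^ 2 ≤ Cup * Λ ^ 2 := mul_le_mul_of_nonneg_right hCule (sq_nonneg Λ)
      have hsplit : D * (Λ ^ 3 / 2 - 1 / β') = D * (Λ ^ 3 / 2) - D * (1 / β') := by ring
      rw [hsplit, hC]
      linarith
  exact root_of_pow_le (secondValue_su2Rep_pos hβ0).le (topValue_su2Rep_pos L β).le hpow

end Summit.QuantumFields.YangMills.Theorems.FemtoTransferGap.CutoffLadder

end
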